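import Literature.MathematicalPhysics.QuantumFieldTheory.BalabanImbrieJaffe1984to88.BIJ88Ineq217NearPart
import Literature.MathematicalPhysics.QuantumFieldTheory.BalabanImbrieJaffe1984to88.BIJ88Sect4Statements

/-!
# `BalabanImbrieJaffe1984to88.BIJ88Smooth43Axial` — T. Bałaban, J. Imbrie, A. Jaffe, *Effective action and cluster properties of the
abelian Higgs model*, Commun. Math. Phys. **114** (1988) 257–315 [BalabanImbrieJaffe1988], Sect. 5.6 p. 286 [PDF 30], the FIRST STEP
of the verification of the regularity condition (4.3): *"In □′ … we can write u = exp[ie_k(∂λ + B)] with |B(b)| ≦ cp(e_k)r(e_k). We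
have f^{(k)} = ∂B in the cube"* — the U(1) lattice Poincaré lemma WITH BRANCH CONTROL, PROVED on the torus carrier of record
(file 1 of 2: the axial potential `B` and its three bounds; file 2 `BIJ88Smooth43AxialRegular` packages them as r18's (4.3) predicate
`BIJ88Sect4Statements.Smooth43` and r16's `BIJ88Regularity286.Regular286`, and discharges the smallness for `e_k` small).

statement-level skeleton of published theorems with citation tags; proofs where landed; nothing here is a claim about the Yang–Mills mass gap

PDF held: `paper:balaban1988-cmp114-bij-abelian-higgs-effective-action` (journal page = PDF page + 256); p. 286 [PDF 30] read this
session on the store's text layer (`lit read … --pages 29-31`) and against r16's image read quoted in `BIJ88Regularity286`.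

CITATION HEADER (lean-in-tree rule).  Part of the lit-balaban TYPED SKELETON (HOME `run/shared/lean/pub/lit-balaban/`), PHASE-2
proof seat p36 gen 6 (unit `lit-balaban-p36`; TAKING line HOME/STATUS.md 2026-08-21T09:44Z).  WHAT IS REPRODUCED: the located
sentence of row **C2.Claim@286** (owner r16, `ROWS-C2-part2.md`; r16's `BIJ88Regularity286` types the claim as `Regular286` over
r18's `Smooth43` and proves the two printed book-keeping mechanisms; its honest-scope note *"no bound is asserted"* is what these two
files start to fill), toward an inhabitant of row **C2.Eq4.3** (owner r18, `BIJ88Sect4Statements.Smooth43`; file 2).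

THE PRINT, p. 286 [PDF 30], verbatim.  *"We need to check the regularity condition on ũ_{k+1}. It states that there exists a gauge
transformation ũ_{k+1} → ũ^λ_{k+1} in each r(e_k)-cube □ ⊂ Λ̄₁^{(k)} such that ũ^λ_{k+1} = exp(ie_kηA^λ) with |A^λ|, |∂A^λ|, |∂*A^λ|
≦ cp(e_k)r(e_k). … We verify the bound by first checking it for u_k, then noticing that all the operations changing u_k into
ũ_{k+1} did not destroy the bound. We use the new bounds on u(p) in Λ₀^{(k)**} to estimate u_k = (Q^{s*}_ku) exp[−ie_kη𝒟_{k,loc}∂*Q^{e*}_k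
f^{(k)}] (5.6.3) with constants uniform in k. … Thus we can assume that |f^{(k)}(p)| ≦ cp(e_k) … Fix □ ⊂ Λ̄₁^{(k)} for estimating
ũ_{k+1}. In □′ [a neighborhood of □ of width ½r(e_k)] we can write u = exp[ie_k(∂λ + B)] with |B(b)| ≦ cp(e_k)r(e_k). We have
f^{(k)} = ∂B in the cube"*.  Here `u` is the new unit-lattice field on `T₁^{(k)}`, `f^{(k)}(p) = (ie_k)⁻¹ log u(p)` ((3.26)/(4.5);
r18's `BIJ88Sect3Statements.fieldStrength`), `∂` the unit-lattice curl (`LatticeFieldCalculus.curl 1`).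

THE ARGUMENT (the print gives none; this is the standard one).  On a box `□′ = [lo, lo + n]^d` of the torus that does not wrap
(`n < sitesPerDir`) take the corner-rooted axial gauge `h` of the tree (`T4AxialGaugeSmallField.axialGauge`, any `GaugeGroup`; here
`G = U(1) = Matrix.unitaryGroup (Fin 1) ℂ`, r18's `U1`): tree bonds of `u^h` are `1`, and the holonomy of every other box bond is a
product of at most `(d−1)·n` plaquette variables, so `|u^h(b) − 1| ≦ (d−1)·n·max_{□′}|u(p) − 1| ≦ (d−1)·n·e_k·a` when
`|f^{(k)}(p)| ≦ a` (the non-abelian Poincaré lemma `T4AxialGaugeSmallField.dist1_axial_bond_le_uniform` BY NAME, transported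
through the 1×1 operator norm `dist1 g = |toC g − 1|`).  Put `λ := arg ∘ h` and `B(b) := arg(u^h(b))/e_k` on the box bonds (`0`
elsewhere): then `u^λ = e^{ie_kB}` on `□′`, `|B| ≦ (π/2)(d−1)·n·a` (`|arg z| ≦ (π/2)|z − 1|` on the unit circle), and on every box
plaquette `e^{ie_k(∂B)(p)} = u^λ(∂p) = u(∂p) = e^{i·arg u(p)}`, so `e_k(∂B)(p) − arg u(p) ∈ 2πℤ` with modulus `≦ (2π(d−1)n + 1)e_ka`;
under the smallness `(2π(d−1)n + 1)·e_k·a < 2π` (`a = cp(e_k)`, `n ≈ 2r(e_k)`: *"e ≪ 1"* p. 273 — made explicit; discharged for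
`e_k → 0⁺` in file 2) this forces **`∂B = f^{(k)}` EXACTLY** on `□′`; finally `|∂*B| ≦ 2d·max|B|`.

WHAT IS PROVED (0 `sorry`, standard axioms; two `def`s with bodies — the gauge function `lamOf h = arg ∘ toC ∘ h` and the axial
potential `axialB` — no `Prop`-valued definition, no new named fact).
* §0 U(1) toolkit: **`dist1_eq_norm_toC_sub_one`** (via the private `1×1` operator-norm computation `norm_matrix_fin_one`)
  (`dist1 g = |toC g − 1|` on `U1` — the bridge between the cell's `GaugeGroup` interface and r18's ℂ-valued typing `cfg`),
  `norm_sub_one_le_abs_arg` / `abs_arg_le_pi_div_two_mul` (chord vs. arc on the unit circle), `norm_plaqVar_cfg`,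
  `dist1_plaqHol_eq`, `dist1_plaqHol_le_abs_arg`, `fieldStrength_of_norm_one` (`f = arg u(p)/e_k`, real), `norm_fieldStrength_cfg`,
  `abs_arg_le_iff_norm_fieldStrength_le` (the printed `|f^{(k)}(p)| ≦ a` IS `|arg u(p)| ≦ e_ka`).
* §1 the dictionary `exp_lamOf`, **`gaugeU_lamOf_cfg`** (`gaugeU (lamOf h) (cfg U) = cfg (U^h)`: r18's real gauge functions versus
  `Setup.GaugeField.gaugeAct`).
* §2 THE AXIAL POTENTIAL `axialB e_k U lo hi`: `axialB_of_mem`, **`gaugeU_axial_eq_exp`** (`u^λ = e^{ie_kB}` on box bonds),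
  `dist1_gaugeAct_axialGauge_le_of_arg` / `abs_arg_gaugeAct_axialGauge_le` (the transported Poincaré bound), **`abs_axialB_le`**
  (`|B| ≦ (π/2)(d−1)na` everywhere), `plaqVar_gaugeU_axial_eq_exp_curl` (`u^λ(∂p) = e^{ie_k∂B(p)}`), **`curl_axialB_eq`** (`∂B = arg u(p)/e_k` on box plaquettes, under the smallness),
  **`fieldStrength_eq_curl_axialB`** (*"We have f^{(k)} = ∂B in the cube"*), `abs_curl_axialB_le` (`≦ a`), **`abs_diverg_axialB_le`**
  (`≦ πd(d−1)na` at every site); §2b (v1.1) `cfg_eq_exp_grad_add_axialB`: the printed form itself, `u(b) = exp(ie_k((∂λ′)(b) + B(b)))`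
  on the box bonds, `λ′ = lamOf h/e_k`, `∂λ′ = grad 1 λ′` (the shape consumed by p31's (5.6.3)–(5.6.4) file `BIJ88Eq564Torus`).
HONEST SCOPE.  This is the FIRST printed step only («first checking it for u»): the unit-lattice field `u` is smooth in the sense
of (4.3) on every non-wrapping box where its plaquette variables are small.  NOT touched: the η-lattice passage (5.6.3)–(5.6.5)
(`u_k = (Q^{s*}_ku)·exp[…]`, the kernels `𝒟_{k,loc}`, `H_{k,loc}`, `w₁` and their derivative bounds) that carries the bound to
`u_k`/`ũ_{k+1}` — r16's note in `BIJ88Regularity286` stands; the axial gauge alone does NOT give the `∂*`-bound at lattice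
spacing `ζ < 1` (the divergence of the axial potential is `O(ζ⁻¹)`), which is why the paper routes the fine-lattice field through
(5.6.4)–(5.6.5).  The box must not wrap (`n < sitesPerDir`), as in `T4AxialGaugeSmallField`; constants explicit, not optimised.
Seat p36 gen 6 (literature-prover-lit-balaban-p36-g6-0), 2026-08-21.  NOT summit progress.
-/

namespace Literature.MathematicalPhysics.QuantumFieldTheory.BalabanImbrieJaffe1984to88.BIJ88Smooth43Axial

open Balaban1983to89 hiding Site Plaq
open Balaban1983to89.LatticeFieldCalculus Balaban1983to89.T4AxialGaugeSmallField
open BIJ88Sect3Statements (U1 toC toC_mul toC_one toC_inv norm_toC cfg gaugeU plaqVar plaqVar_cfg plaqVar_gauge fieldStrength)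
open BIJ88Ineq217NearPart (boxCut boxCut_of_mem boxCut_of_not_mem abs_boxCut_le abs_curl_le bonds_mem_boxBonds
  boxPlaqSmall_pull_of_le curl_one)
open Balaban1983to89.B7Prop1Explicit (e e_apply)
open Balaban1983to89.B8Lemma1NonAbelian (e_nonneg)
open Complex
open scoped Real

noncomputable section

-- The torus carriers of `Setup` under fresh names (the bare names `Site`/`Plaq` resolve to unrelated `ℤ^d` carriers declared at the
-- `QuantumFieldTheory` root by files in the import closure of the axial-gauge machinery; same device as `BIJ88Ineq217NearPart`).
open Balaban1983to89 renaming Site → TSite, Plaq → TPlaq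

variable {P : Params} {j : ℕ}

/-! ## §0  U(1) toolkit: the interface distance `dist1` on `U1`, chord versus arc, the field strength as an angle -/

section L2Op

open scoped Matrix.Norms.L2Operator

/-- The L²-operator norm of a `1 × 1` complex matrix is the modulus of its entry (plumbing for `dist1` on `U1`). [folklore] -/
private theorem norm_matrix_fin_one (M : Matrix (Fin 1) (Fin 1) ℂ) : ‖M‖ = ‖M 0 0‖ := by
  have h : M = Matrix.diagonal (fun i => M i i) := by
    ext i k; fin_cases i; fin_cases k; simp
  rw [h, Matrix.l2_opNorm_diagonal]
  apply le_antisymm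
  · refine (pi_norm_le_iff_of_nonneg (norm_nonneg _)).2 ?_
    intro i; fin_cases i; simp
  · exact norm_le_pi_norm (fun i : Fin 1 => M i i) 0

/-- **`dist1 g = |toC g − 1|` on `U(1)`**: the cell's interface distance (`UnitaryModel.instGaugeGroupUnitaryGroup`: the operator norm
`‖g − 1‖`) is the distance of the single entry to `1` — the bridge to r18's ℂ-valued typing `cfg U = toC ∘ U` of the abelian field.
[cite: BalabanImbrieJaffe1988, (1.1) p.258] -/
theorem dist1_eq_norm_toC_sub_one (g : U1) : dist1 g = ‖toC g - 1‖ := by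
  show UnitaryModel.opDist1 (g : Matrix (Fin 1) (Fin 1) ℂ) = _
  unfold UnitaryModel.opDist1
  rw [norm_matrix_fin_one]
  simp [toC]

end L2Op

/-- A unit complex number is the exponential of its principal argument, `v = exp(i·arg v)` (Mathlib's
`Complex.norm_mul_exp_arg_mul_I` at `‖v‖ = 1`; plumbing). [folklore] -/
private theorem exp_arg_mul_I {z : ℂ} (hz : ‖z‖ = 1) : exp (arg z * I) = z := by
  have h := Complex.norm_mul_exp_arg_mul_I z
  rwa [hz, Complex.ofReal_one, one_mul] at h

/-- kernel relating the two printed plaquette restrictions, `|u(p) − 1| ≦ e_kp(e_k)` (p. 280) and `|f^{(k)}(p)| ≦ cp(e_k)` (4.5):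
CHORD ≦ ARC on the unit circle, `|z − 1| ≦ |arg z|`. [cite: BalabanImbrieJaffe1988, (4.5) p.274] -/
theorem norm_sub_one_le_abs_arg {z : ℂ} (hz : ‖z‖ = 1) : ‖z - 1‖ ≤ |arg z| := by
  have h1 : ‖exp (I * (arg z : ℝ)) - 1‖ = ‖2 * Real.sin (arg z / 2)‖ := Complex.norm_exp_I_mul_ofReal_sub_one (arg z)
  rw [mul_comm I, exp_arg_mul_I hz] at h1
  rw [h1, Real.norm_eq_abs, abs_mul, abs_two]
  have h2 : |Real.sin (arg z / 2)| ≤ |arg z / 2| := Real.abs_sin_le_abs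
  rw [abs_div, abs_two] at h2
  linarith

/-- kernel relating the two printed plaquette restrictions (converse direction): ARC ≦ (π/2)·CHORD on the unit circle (Jordan's
inequality), `|arg z| ≦ (π/2)|z − 1|`. [cite: BalabanImbrieJaffe1988, (4.5) p.274] -/
theorem abs_arg_le_pi_div_two_mul {z : ℂ} (hz : ‖z‖ = 1) : |arg z| ≤ π / 2 * ‖z - 1‖ := by
  have h1 : ‖exp (I * (arg z : ℝ)) - 1‖ = ‖2 * Real.sin (arg z / 2)‖ := Complex.norm_exp_I_mul_ofReal_sub_one (arg z)
  rw [mul_comm I, exp_arg_mul_I hz] at h1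
  rw [h1, Real.norm_eq_abs, abs_mul, abs_two]
  -- `|arg z / 2| ≤ π / 2`, so Jordan's inequality applies to `|arg z / 2|`
  have hle : |arg z / 2| ≤ π / 2 := by
    rw [abs_div, abs_two]
    have := Complex.abs_arg_le_pi z
    linarith
  have hJ := Real.mul_le_sin (abs_nonneg (arg z / 2)) hle
  have hb := abs_le.1 hle
  have hsin : Real.sin |arg z / 2| = |Real.sin (arg z / 2)| := by
    rcases le_or_gt 0 (arg z / 2) with h | h
    · rw [abs_of_nonneg h, abs_of_nonneg (Real.sin_nonneg_of_nonneg_of_le_pi h (by linarith [Real.pi_pos, hb.2]))]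
    · rw [abs_of_neg h, Real.sin_neg,
        abs_of_neg (Real.sin_neg_of_neg_of_neg_pi_lt h (by linarith [Real.pi_pos, hb.1]))]
  rw [hsin, abs_div, abs_two] at hJ
  have hπ := Real.pi_pos
  -- `2/π · (|arg z|/2) ≤ |sin(arg z/2)|` ⟹ `|arg z| ≤ π · |sin(arg z/2)| = (π/2)·(2|sin(arg z/2)|)`
  have : |arg z| ≤ π * |Real.sin (arg z / 2)| := by
    have h3 : 2 / π * (|arg z| / 2) * π ≤ |Real.sin (arg z / 2)| * π := mul_le_mul_of_nonneg_right hJ hπ.le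
    have h4 : 2 / π * (|arg z| / 2) * π = |arg z| := by field_simp
    linarith
  linarith

/-- The plaquette variable of a `U(1)` configuration has modulus one. [cite: BalabanImbrieJaffe1988, (3.3) p.265] -/
theorem norm_plaqVar_cfg (U : GaugeField P j U1) (p : TPlaq P j) : ‖plaqVar (cfg U) p‖ = 1 := by
  rw [plaqVar_cfg, norm_toC]

/-- `dist1 (U(∂p)) = |u(p) − 1|`. [cite: BalabanImbrieJaffe1988, (3.3) p.265] -/
theorem dist1_plaqHol_eq (U : GaugeField P j U1) (p : TPlaq P j) :
    dist1 (GaugeField.plaqHol U p) = ‖plaqVar (cfg U) p - 1‖ := by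
  rw [dist1_eq_norm_toC_sub_one, plaqVar_cfg]

/-- `dist1 (U(∂p)) ≦ |arg u(p)|` (= `e_k|f^{(k)}(p)|`). [cite: BalabanImbrieJaffe1988, (4.5) p.274] -/
theorem dist1_plaqHol_le_abs_arg (U : GaugeField P j U1) (p : TPlaq P j) :
    dist1 (GaugeField.plaqHol U p) ≤ |arg (plaqVar (cfg U) p)| := by
  rw [dist1_plaqHol_eq]
  exact norm_sub_one_le_abs_arg (norm_plaqVar_cfg U p)

/-- THE FIELD STRENGTH IS AN ANGLE: for `|v| = 1`, `f = (ie)⁻¹ log v = arg v / e` (real; r18's `fieldStrength`, principal `log`).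
[cite: BalabanImbrieJaffe1988, (3.26) p.269] -/
theorem fieldStrength_of_norm_one (e₀ : ℝ) {v : ℂ} (hv : ‖v‖ = 1) : fieldStrength e₀ v = ((arg v / e₀ : ℝ) : ℂ) := by
  have hlog : Complex.log v = arg v * I := by rw [Complex.log, hv]; simp
  rw [fieldStrength, hlog, mul_inv_rev, Complex.inv_I]
  push_cast
  have hI2 : I * I = -1 := Complex.I_mul_I
  calc (e₀ : ℂ)⁻¹ * -I * ((arg v : ℂ) * I) = -(I * I) * ((arg v : ℂ) / e₀) := by ring
    _ = (arg v : ℂ) / e₀ := by rw [hI2]; ring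

/-- Hence `|f^{(k)}(p)| = |arg u(p)|/e_k` (`e_k > 0`). [cite: BalabanImbrieJaffe1988, (4.5) p.274] -/
theorem norm_fieldStrength_cfg {ek : ℝ} (hek : 0 < ek) (U : GaugeField P j U1) (p : TPlaq P j) :
    ‖fieldStrength ek (plaqVar (cfg U) p)‖ = |arg (plaqVar (cfg U) p)| / ek := by
  rw [fieldStrength_of_norm_one ek (norm_plaqVar_cfg U p), Complex.norm_real, Real.norm_eq_abs, abs_div, abs_of_pos hek]

/-- The printed restriction `|f^{(k)}(p)| ≦ a` IS `|arg u(p)| ≦ e_k·a`. [cite: BalabanImbrieJaffe1988, (4.5) p.274] -/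
theorem abs_arg_le_iff_norm_fieldStrength_le {ek : ℝ} (hek : 0 < ek) (U : GaugeField P j U1) (p : TPlaq P j) (a : ℝ) :
    |arg (plaqVar (cfg U) p)| ≤ ek * a ↔ ‖fieldStrength ek (plaqVar (cfg U) p)‖ ≤ a := by
  rw [norm_fieldStrength_cfg hek, div_le_iff₀ hek, mul_comm]

/-! ## §1  The dictionary: r18's real gauge functions versus `Setup`'s group-valued gauge transformations -/

/-- The real gauge function of a `U(1)`-valued gauge transformation: `λ(x) = arg h(x)`, so `e^{iλ(x)} = h(x)`.
[cite: BalabanImbrieJaffe1988, (4.3) p.274] -/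
def lamOf (h : GaugeTransf P j U1) : TSite P j → ℝ := fun x => arg (toC (h x))

/-- `e^{iλ(x)} = toC (h x)`. [cite: BalabanImbrieJaffe1988, (4.3) p.274] -/
theorem exp_lamOf (h : GaugeTransf P j U1) (x : TSite P j) : exp ((lamOf h x : ℂ) * I) = toC (h x) :=
  exp_arg_mul_I (norm_toC _)

/-- **`u^λ = (U^h)` read in `ℂ`**: r18's `gaugeU λ u b = e^{iλ(b₋)}u(b)e^{−iλ(b₊)}` at `λ = lamOf h`, `u = cfg U` is `Setup`'s
`U^h(b) = h(b₋)U(b)h(b₊)⁻¹`. [cite: BalabanImbrieJaffe1988, (4.3) p.274] -/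
theorem gaugeU_lamOf_cfg (h : GaugeTransf P j U1) (U : GaugeField P j U1) :
    gaugeU (lamOf h) (cfg U) = cfg (GaugeField.gaugeAct h U) := by
  funext b
  have h1 : exp ((lamOf h b.src : ℂ) * I) = toC (h b.src) := exp_lamOf h b.src
  have h2 : exp (-((lamOf h b.tgt : ℂ) * I)) = toC (h b.tgt)⁻¹ := by
    rw [Complex.exp_neg, exp_lamOf h b.tgt, toC_inv, Complex.inv_eq_conj (norm_toC _)]
  simp only [gaugeU, cfg, GaugeField.gaugeAct, toC_mul, h1, h2]

/-! ## §2  The axial potential on a non-wrapping box -/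

/-- THE AXIAL POTENTIAL `B` of p. 286 on the box `[lo, hi]`: `B(b) = arg(U^h(b))/e_k` with `h` the corner-rooted axial gauge of the
box (`T4AxialGaugeSmallField.axialGauge`), cut off to `0` outside the box bonds (`BIJ88Ineq217NearPart.boxCut`).
[cite: BalabanImbrieJaffe1988, (4.3) p.286] -/
def axialB (ek : ℝ) (U : GaugeField P j U1) (lo hi : Fin P.d → ℤ) : VecField P j ℝ :=
  boxCut lo hi fun b => arg (toC (GaugeField.gaugeAct (axialGauge U lo hi) U b)) / ek

/-- On a box bond `B(b) = arg(U^h(b))/e_k`. [cite: BalabanImbrieJaffe1988, (4.3) p.286] -/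
theorem axialB_of_mem (ek : ℝ) (U : GaugeField P j U1) {lo hi : Fin P.d → ℤ} {b : PBond P j} (hb : b ∈ boxBonds lo hi) :
    axialB ek U lo hi b = arg (toC (GaugeField.gaugeAct (axialGauge U lo hi) U b)) / ek :=
  boxCut_of_mem _ hb

/-- **`u^λ = exp(ie_kB)` on the box bonds** (*"we can write u = exp[ie_k(∂λ + B)]"*): with `λ = lamOf (axialGauge U lo hi)`,
`gaugeU λ (cfg U) b = e^{ie_kB(b)}`. [cite: BalabanImbrieJaffe1988, (4.3) p.286] -/
theorem gaugeU_axial_eq_exp {ek : ℝ} (hek : ek ≠ 0) (U : GaugeField P j U1) {lo hi : Fin P.d → ℤ} {b : PBond P j}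
    (hb : b ∈ boxBonds lo hi) :
    gaugeU (lamOf (axialGauge U lo hi)) (cfg U) b = exp (I * ((ek * axialB ek U lo hi b : ℝ) : ℂ)) := by
  rw [gaugeU_lamOf_cfg, axialB_of_mem ek U hb, mul_div_cancel₀ _ hek, mul_comm I]
  exact (exp_arg_mul_I (norm_toC _)).symm

/-- The Poincaré bound transported: `dist1 (U^h(b)) ≦ (d−1)·n·(e_k a)` on every bond of the box `[lo, hi]` (`n + 1` sites per
direction, `n < sitesPerDir j`) when `|arg u(p)| ≦ e_k a` on the box plaquettes — `T4AxialGaugeSmallField.dist1_axial_bond_le_uniform`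
BY NAME through `dist1_plaqHol_le_abs_arg`. [cite: BalabanImbrieJaffe1988, (4.3) p.286] -/
theorem dist1_gaugeAct_axialGauge_le_of_arg (U : GaugeField P j U1) {lo hi : Fin P.d → ℤ} {δ : ℝ} {n : ℕ} (hδ : 0 ≤ δ)
    (hf : ∀ p ∈ boxPlaqs lo hi, |arg (plaqVar (cfg U) p)| ≤ δ) (hn : ∀ κ, hi κ ≤ lo κ + n) (hnN : n < P.sitesPerDir j)
    {b : PBond P j} (hb : b ∈ boxBonds lo hi) :
    dist1 (GaugeField.gaugeAct (axialGauge U lo hi) U b) ≤ ((P.d - 1 : ℕ) : ℝ) * n * δ := by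
  have hN : ∀ κ, hi κ - lo κ < P.sitesPerDir j := fun κ => by
    have h1 := hn κ
    have h2 : (n : ℤ) < (P.sitesPerDir j : ℤ) := by exact_mod_cast hnN
    linarith
  have hP : BoxPlaqSmall (pull U) lo hi δ :=
    boxPlaqSmall_pull_of_le U fun p hp => (dist1_plaqHol_le_abs_arg U p).trans (hf p hp)
  obtain ⟨x, hx, hxμ, hsrc⟩ := hb
  obtain ⟨src, dir⟩ := b
  simp only at hsrc hxμ
  subst hsrc
  rw [gaugeAct_axialGauge_castSite U hN hx hxμ]
  exact dist1_axial_bond_le_uniform (pull U) hP hδ hn x dir hx hxμ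

/-- `|arg U^h(b)| ≦ (π/2)(d−1)·n·δ` on the box bonds. [cite: BalabanImbrieJaffe1988, (4.3) p.286] -/
theorem abs_arg_gaugeAct_axialGauge_le (U : GaugeField P j U1) {lo hi : Fin P.d → ℤ} {δ : ℝ} {n : ℕ} (hδ : 0 ≤ δ)
    (hf : ∀ p ∈ boxPlaqs lo hi, |arg (plaqVar (cfg U) p)| ≤ δ) (hn : ∀ κ, hi κ ≤ lo κ + n) (hnN : n < P.sitesPerDir j)
    {b : PBond P j} (hb : b ∈ boxBonds lo hi) :
    |arg (toC (GaugeField.gaugeAct (axialGauge U lo hi) U b))| ≤ π / 2 * (((P.d - 1 : ℕ) : ℝ) * n * δ) := by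
  refine (abs_arg_le_pi_div_two_mul (norm_toC _)).trans (mul_le_mul_of_nonneg_left ?_ (by positivity))
  rw [← dist1_eq_norm_toC_sub_one]
  exact dist1_gaugeAct_axialGauge_le_of_arg U hδ hf hn hnN hb

/-- **`|B(b)| ≦ (π/2)(d−1)·n·a`** for EVERY bond (*"with |B(b)| ≦ cp(e_k)r(e_k)"*: `a = cp(e_k)`, `n ≈ 2r(e_k)`), when
`|arg u(p)| ≦ e_k a` on the box plaquettes (`e_k > 0`, `a ≧ 0`). [cite: BalabanImbrieJaffe1988, (4.3) p.286] -/
theorem abs_axialB_le {ek a : ℝ} (hek : 0 < ek) (ha : 0 ≤ a) (U : GaugeField P j U1) {lo hi : Fin P.d → ℤ} {n : ℕ}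
    (hf : ∀ p ∈ boxPlaqs lo hi, |arg (plaqVar (cfg U) p)| ≤ ek * a) (hn : ∀ κ, hi κ ≤ lo κ + n) (hnN : n < P.sitesPerDir j)
    (b : PBond P j) : |axialB ek U lo hi b| ≤ π / 2 * (((P.d - 1 : ℕ) : ℝ) * n * a) := by
  refine abs_boxCut_le (by positivity) (fun b hb => ?_) b
  rw [abs_div, abs_of_pos hek, div_le_iff₀ hek]
  calc |arg (toC (GaugeField.gaugeAct (axialGauge U lo hi) U b))| ≤ π / 2 * (((P.d - 1 : ℕ) : ℝ) * n * (ek * a)) :=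
        abs_arg_gaugeAct_axialGauge_le U (mul_nonneg hek.le ha) hf hn hnN hb
    _ = π / 2 * (((P.d - 1 : ℕ) : ℝ) * n * a) * ek := by ring

/-- Conjugation of a pure phase: `conj e^{it} = e^{−it}`. [folklore] -/
private theorem conj_exp_I_mul (t : ℝ) : (starRingEnd ℂ) (exp (I * (t : ℂ))) = exp (-(I * (t : ℂ))) := by
  rw [← exp_conj]
  simp [conj_ofReal]

/-- `u^λ(∂p) = exp(ie_k(∂B)(p))` on the box plaquettes (the four bonds of a box plaquette are box bonds,
`BIJ88Ineq217NearPart.bonds_mem_boxBonds`; `∂` = `LatticeFieldCalculus.curl 1`). [cite: BalabanImbrieJaffe1988, (4.3) p.286] -/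
theorem plaqVar_gaugeU_axial_eq_exp_curl {ek : ℝ} (hek : ek ≠ 0) (U : GaugeField P j U1) {lo hi : Fin P.d → ℤ}
    {p : TPlaq P j} (hp : p ∈ boxPlaqs lo hi) :
    plaqVar (gaugeU (lamOf (axialGauge U lo hi)) (cfg U)) p = exp (I * ((ek * curl 1 (axialB ek U lo hi) p : ℝ) : ℂ)) := by
  obtain ⟨h1, h2, h3, h4⟩ := bonds_mem_boxBonds hp
  rw [plaqVar, gaugeU_axial_eq_exp hek U h1, gaugeU_axial_eq_exp hek U h2, gaugeU_axial_eq_exp hek U h3,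
    gaugeU_axial_eq_exp hek U h4, conj_exp_I_mul, conj_exp_I_mul, ← Complex.exp_add, ← Complex.exp_add, ← Complex.exp_add,
    curl_one]
  congr 1
  push_cast
  ring

/-- A real number `t` with `e^{it} = 1` and `|t| < 2π` vanishes. [folklore] -/
private theorem eq_zero_of_exp_eq_one_of_abs_lt {t : ℝ} (h : exp (I * (t : ℂ)) = 1) (ht : |t| < 2 * π) : t = 0 := by
  obtain ⟨n, hn⟩ := Complex.exp_eq_one_iff.1 h
  have hre : t = n * (2 * π) := by
    have := congrArg Complex.im hn
    simpa using this
  have habs : |(n : ℝ)| * (2 * π) < 1 * (2 * π) := by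
    have h' : |t| = |(n : ℝ)| * (2 * π) := by rw [hre, abs_mul, abs_of_pos Real.two_pi_pos]
    linarith
  have hn0 : |(n : ℝ)| < 1 := lt_of_mul_lt_mul_right habs Real.two_pi_pos.le
  have : n = 0 := by
    have h' : |n| < 1 := by exact_mod_cast hn0
    exact Int.abs_lt_one_iff.mp h'
  rw [hre, this]; simp

/-- **`∂B = arg u(p)/e_k` on the box plaquettes** — the curl of the axial potential IS the plaquette angle, exactly, under the
smallness `(2π(d−1)n + 1)·e_k·a < 2π` (both `e_k(∂B)(p)` and `arg u(p)` are small and `e^{ie_k∂B(p)} = u^λ(∂p) = u(∂p) = e^{i arg u(p)}`).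
[cite: BalabanImbrieJaffe1988, (4.3) p.286] -/
theorem curl_axialB_eq {ek a : ℝ} (hek : 0 < ek) (ha : 0 ≤ a) (U : GaugeField P j U1) {lo hi : Fin P.d → ℤ} {n : ℕ}
    (hf : ∀ p ∈ boxPlaqs lo hi, |arg (plaqVar (cfg U) p)| ≤ ek * a) (hn : ∀ κ, hi κ ≤ lo κ + n) (hnN : n < P.sitesPerDir j)
    (hsmall : (2 * π * ((P.d - 1 : ℕ) : ℝ) * n + 1) * (ek * a) < 2 * π) {p : TPlaq P j} (hp : p ∈ boxPlaqs lo hi) :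
    curl 1 (axialB ek U lo hi) p = arg (plaqVar (cfg U) p) / ek := by
  set θ := arg (plaqVar (cfg U) p) with hθ
  set S := ek * curl 1 (axialB ek U lo hi) p with hS
  -- `e^{iS} = u(∂p) = e^{iθ}`
  have hexpS : exp (I * (S : ℂ)) = plaqVar (cfg U) p := by
    rw [hS, ← plaqVar_gaugeU_axial_eq_exp_curl hek.ne' U hp, plaqVar_gauge]
  have hexpθ : exp (I * (θ : ℂ)) = plaqVar (cfg U) p := by
    rw [mul_comm]; exact exp_arg_mul_I (norm_plaqVar_cfg U p)
  have hone : exp (I * ((S - θ : ℝ) : ℂ)) = 1 := by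
    have hne : plaqVar (cfg U) p ≠ 0 := by
      intro h0; have := norm_plaqVar_cfg U p; rw [h0, norm_zero] at this; exact zero_ne_one this
    rw [ofReal_sub, mul_sub, Complex.exp_sub, hexpS, hexpθ, div_self hne]
  -- both are small
  have hB : ∀ b, |axialB ek U lo hi b| ≤ π / 2 * (((P.d - 1 : ℕ) : ℝ) * n * a) := abs_axialB_le hek ha U hf hn hnN
  have hSle : |S| ≤ ek * (4 * (π / 2 * (((P.d - 1 : ℕ) : ℝ) * n * a))) := by
    rw [hS, abs_mul, abs_of_pos hek]
    refine mul_le_mul_of_nonneg_left ?_ hek.le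
    simpa using abs_curl_le (c := (1 : ℝ)) hB p
  have hθle : |θ| ≤ ek * a := hf p hp
  have hlt : |S - θ| < 2 * π := by
    calc |S - θ| ≤ |S| + |θ| := abs_sub _ _
      _ ≤ ek * (4 * (π / 2 * (((P.d - 1 : ℕ) : ℝ) * n * a))) + ek * a := add_le_add hSle hθle
      _ = (2 * π * ((P.d - 1 : ℕ) : ℝ) * n + 1) * (ek * a) := by ring
      _ < 2 * π := hsmall
  have h0 : S - θ = 0 := eq_zero_of_exp_eq_one_of_abs_lt hone hlt
  have hSθ : S = θ := sub_eq_zero.1 h0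
  rw [eq_div_iff hek.ne', mul_comm]
  exact hSθ

/-- **"We have f^{(k)} = ∂B in the cube"**: on the box plaquettes the field strength `f^{(k)}(p) = (ie_k)⁻¹ log u(p)` (r18's
`fieldStrength`) equals the unit-lattice curl of the axial potential. [cite: BalabanImbrieJaffe1988, (4.3) p.286] -/
theorem fieldStrength_eq_curl_axialB {ek a : ℝ} (hek : 0 < ek) (ha : 0 ≤ a) (U : GaugeField P j U1) {lo hi : Fin P.d → ℤ}
    {n : ℕ} (hf : ∀ p ∈ boxPlaqs lo hi, |arg (plaqVar (cfg U) p)| ≤ ek * a) (hn : ∀ κ, hi κ ≤ lo κ + n)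
    (hnN : n < P.sitesPerDir j) (hsmall : (2 * π * ((P.d - 1 : ℕ) : ℝ) * n + 1) * (ek * a) < 2 * π) {p : TPlaq P j}
    (hp : p ∈ boxPlaqs lo hi) : fieldStrength ek (plaqVar (cfg U) p) = ((curl 1 (axialB ek U lo hi) p : ℝ) : ℂ) := by
  rw [fieldStrength_of_norm_one ek (norm_plaqVar_cfg U p), curl_axialB_eq hek ha U hf hn hnN hsmall hp]

/-- `|∂B(p)| ≦ a` on the box plaquettes. [cite: BalabanImbrieJaffe1988, (4.3) p.286] -/
theorem abs_curl_axialB_le {ek a : ℝ} (hek : 0 < ek) (ha : 0 ≤ a) (U : GaugeField P j U1) {lo hi : Fin P.d → ℤ} {n : ℕ}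
    (hf : ∀ p ∈ boxPlaqs lo hi, |arg (plaqVar (cfg U) p)| ≤ ek * a) (hn : ∀ κ, hi κ ≤ lo κ + n) (hnN : n < P.sitesPerDir j)
    (hsmall : (2 * π * ((P.d - 1 : ℕ) : ℝ) * n + 1) * (ek * a) < 2 * π) {p : TPlaq P j} (hp : p ∈ boxPlaqs lo hi) :
    |curl 1 (axialB ek U lo hi) p| ≤ a := by
  rw [curl_axialB_eq hek ha U hf hn hnN hsmall hp, abs_div, abs_of_pos hek, div_le_iff₀ hek, mul_comm]
  exact hf p hp

/-- **`|∂*B(x)| ≦ πd(d−1)·n·a`** at EVERY site (`∂*` = `LatticeFieldCalculus.diverg 1`: `2d` bonds meet a site, each carries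
`|B| ≦ (π/2)(d−1)na`). [cite: BalabanImbrieJaffe1988, (4.3) p.286] -/
theorem abs_diverg_axialB_le {ek a : ℝ} (hek : 0 < ek) (ha : 0 ≤ a) (U : GaugeField P j U1) {lo hi : Fin P.d → ℤ} {n : ℕ}
    (hf : ∀ p ∈ boxPlaqs lo hi, |arg (plaqVar (cfg U) p)| ≤ ek * a) (hn : ∀ κ, hi κ ≤ lo κ + n) (hnN : n < P.sitesPerDir j)
    (x : TSite P j) : |diverg 1 (axialB ek U lo hi) x| ≤ π * P.d * (((P.d - 1 : ℕ) : ℝ) * n * a) := by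
  set M := π / 2 * (((P.d - 1 : ℕ) : ℝ) * n * a) with hM
  have hB : ∀ b, |axialB ek U lo hi b| ≤ M := abs_axialB_le hek ha U hf hn hnN
  unfold diverg
  calc |∑ μ : Fin P.d, (1 : ℝ) • (axialB ek U lo hi ⟨x.unshift μ, μ⟩ - axialB ek U lo hi ⟨x, μ⟩)|
      ≤ ∑ μ : Fin P.d, |(1 : ℝ) • (axialB ek U lo hi ⟨x.unshift μ, μ⟩ - axialB ek U lo hi ⟨x, μ⟩)| :=
        Finset.abs_sum_le_sum_abs _ _
    _ ≤ ∑ _μ : Fin P.d, (M + M) := Finset.sum_le_sum fun μ _ => by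
        rw [one_smul]
        exact (abs_sub _ _).trans (add_le_add (hB _) (hB _))
    _ = π * P.d * (((P.d - 1 : ℕ) : ℝ) * n * a) := by
        rw [Finset.sum_const, Finset.card_univ, Fintype.card_fin, nsmul_eq_mul, hM]
        ring


/-! ## §2b (v1.1)  The printed form `u = exp[ie_k(∂λ + B)]` itself -/

/-- **`u = exp[ie_k(∂λ′ + B)]` on the box bonds, verbatim** (p. 286): with `λ′ := (lamOf (axialGauge U lo hi))/e_k` and `∂λ′(b) =
λ′(b₊) − λ′(b₋)` (`LatticeFieldCalculus.grad 1`), the field itself reads `u(b) = exp(ie_k((∂λ′)(b) + B(b)))`. [cite: BalabanImbrieJaffe1988, (4.3) p.286] -/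
theorem cfg_eq_exp_grad_add_axialB {ek : ℝ} (hek : ek ≠ 0) (U : GaugeField P j U1) {lo hi : Fin P.d → ℤ} {b : PBond P j}
    (hb : b ∈ boxBonds lo hi) :
    cfg U b = exp (I * ((ek * (grad 1 (fun x => lamOf (axialGauge U lo hi) x / ek) b + axialB ek U lo hi b) : ℝ) : ℂ)) := by
  have h := gaugeU_axial_eq_exp hek U hb
  simp only [gaugeU] at h
  set lam := lamOf (axialGauge U lo hi)
  have hne : exp ((lam b.src : ℂ) * I) * exp (-((lam b.tgt : ℂ) * I)) ≠ 0 := mul_ne_zero (exp_ne_zero _) (exp_ne_zero _)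
  have hu : cfg U b = exp (I * ((ek * axialB ek U lo hi b : ℝ) : ℂ)) / (exp ((lam b.src : ℂ) * I) * exp (-((lam b.tgt : ℂ) * I))) := by
    rw [eq_div_iff hne, ← h]; ring
  rw [hu, div_eq_iff hne, ← Complex.exp_add, ← Complex.exp_add]
  congr 1
  have hekC : (ek : ℂ) ≠ 0 := ofReal_ne_zero.2 hek
  simp only [grad, smul_eq_mul, one_mul]
  push_cast
  field_simp
  ring

end

end Literature.MathematicalPhysics.QuantumFieldTheory.BalabanImbrieJaffe1984to88.BIJ88Smooth43Axial
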